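import Summits.AtomisticToContinuum.BoseEinsteinCondensation.Theses.BECClassicalWindow

/-!
# Route `BECClassicalWindow`, assembly item `Assembly` (stmt-AtomisticToContinuum-9076)

Settles the assembly item of route `route-AtomisticToContinuum-BECClassicalWindow`: the implication

  `ThermalWindowZeroMode → ThermalMonotonicity → GroundStateRigidity → ThermalGroundStateLimit →
    OccupationStability → ThermalDescent → BoseEinsteinCondensation`.

Its hypotheses are, verbatim and in the same order, those of the route's deciding theorem `closes`,
so the assembly is that theorem; the composition is spelled out again for the record: the glue
support `ThermalDescent` turns the three thermal items (`ThermalWindowZeroMode`,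
`ThermalMonotonicity`, `ThermalGroundStateLimit`), `GroundStateRigidity` and `OccupationStability`
into X_B1 (stmt-AtomisticToContinuum-0686: macroscopic constant-mode occupation of every
near-minimiser of the Dirichlet energy), and X_B1 → `BoseEinsteinCondensation` is the proved theorem
`AtomisticToContinuum.BECInfraredBound.bec_of_zeroMode`. Pure logic; no analytic content lives here.

Reference: Lieb–Seiringer–Solovej–Yngvason 2005, §1.2 and Ch. 5 (the statement being assembled).
-/

namespace Summit.AtomisticToContinuum.BoseEinsteinCondensation.Theorems

/-- Settles `stmt-AtomisticToContinuum-9076` (exact route decl): the assembly of route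
`BECClassicalWindow`, i.e. its six items imply the sub-problem statement
`BoseEinsteinCondensation`. Proof: `ThermalDescent` fed with the five other items yields X_B1
(every near-minimiser of the Dirichlet energy macroscopically occupies the constant mode), and
`AtomisticToContinuum.BECInfraredBound.bec_of_zeroMode` turns X_B1 into
`BoseEinsteinCondensation`. [folklore] -/
theorem becClassicalWindow_assembly_proof :
    Summit.AtomisticToContinuum.BoseEinsteinCondensation.Theses.BECClassicalWindow.Assembly := by
  unfold Theses.BECClassicalWindow.Assembly
  intro h₁ h₂ h₃ h₄ h₅ h₆
  exact _root_.AtomisticToContinuum.BECInfraredBound.bec_of_zeroMode (h₆ h₁ h₂ h₃ h₄ h₅)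

end Summit.AtomisticToContinuum.BoseEinsteinCondensation.Theorems
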